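import Summits.Langlands.Langlands.Theses.ParityBlindBianchi
import Literature.NumberTheory.GaloisRepresentations.IntegralGaloisActionProofs

/-!
# `ArtinWeightRealisationLevel` (R′, stmt-Langlands-15111): the side condition `p ∈ S₀` is not load-bearing

Negative-side lemmas (crux disprover `cdisprove-stmt-Langlands-15111`, 2026-08-16; supports
stmt-Langlands-15111).

Hypothesis mutation "drop `p ∈ S₀`".  In the hypothesis package of R′ the eigenvalues `a_{v,i}` are
typed in `𝒪_{ℚ̄_p}` (the valuation subring) and Hansen's association at a good place `v` reads
`charpoly σ(Frob_v⁻¹) = X² − a_{v,1} X + q_v a_{v,2}` (`heckeFrobPoly q_v 2`).  Comparing constant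
coefficients, `det σ(Frob_v⁻¹) = q_v · a_{v,2}`; for `σ` of finite image the determinant is a root of
unity, of `p`-adic absolute value `1` (`norm_det_eq_one_of_finite`), while at a place `v ∣ p` the
residue cardinality `q_v` is a positive power of `p` (`residueCard_eq_prime_pow`), so
`‖q_v · a_{v,2}‖ ≤ ‖q_v‖ < 1` — contradiction (`not_isHeckeAssociatedAt_of_mem`).  Hence under the
association clause of the package NO place over `p` can be good (`places_over_p_bad_of_assoc`):
the binder `p ∈ S₀` of R′ (and of E2′) is implied by the rest of the hypothesis up to the choice of
`S₀` (any `S₀` making a place over `p` good has an unsatisfiable package), i.e. it is decoration,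
not a handle — information for the provers (nothing is gained or lost by it) and for the planner
(the crux "without `p ∈ S₀`" is equivalent to the crux; recorded in the crux work file
`Cruxes/ArtinWeightRealisationLevel/Disproof.lean`).
-/

noncomputable section

set_option linter.dupNamespace false -- `Summit.Langlands.Langlands` is the mandated namespace (D-0017)

open scoped NumberField

namespace Summit.Langlands.Langlands.Theorems.ArtinWeightRealisationLevel.Negative

open Literature.NumberTheory.Automorphic Literature.NumberTheory.GaloisRepresentations
  IsDedekindDomain Polynomial

variable {K : Type} [Field K] [NumberField K] {p : ℕ} [Fact p.Prime]

/-- The residue cardinality of a place over `p` is a positive power of `p`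
(`N v ∣ N((p)) = p^{[K:ℚ]}`, `N v > 1`). [folklore] -/
theorem residueCard_eq_prime_pow (v : HeightOneSpectrum (𝓞 K))
    (hv : ((p : ℕ) : 𝓞 K) ∈ v.asIdeal) : ∃ f : ℕ, 0 < f ∧ v.residueCard = p ^ f := by
  have h1 : Ideal.absNorm v.asIdeal ∣ Ideal.absNorm (Ideal.span {((p : ℕ) : 𝓞 K)}) :=
    Ideal.absNorm_dvd_absNorm_of_le ((Ideal.span_singleton_le_iff_mem _).mpr hv)
  rw [Ideal.absNorm_span_singleton, show ((p : ℕ) : 𝓞 K) = algebraMap ℤ (𝓞 K) (p : ℤ) by simp,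
    Algebra.norm_algebraMap, Int.natAbs_pow, Int.natAbs_natCast] at h1
  obtain ⟨f, -, hfeq⟩ := (Nat.dvd_prime_pow (Fact.out : p.Prime)).1 h1
  refine ⟨f, Nat.pos_of_ne_zero ?_, hfeq⟩
  rintro rfl
  have := v.one_lt_residueCard
  rw [show v.residueCard = Ideal.absNorm v.asIdeal from rfl, hfeq, pow_zero] at this
  exact lt_irrefl _ this

/-- At a place over `p`, `‖q_v‖_p < 1` in `ℚ̄_p`. [folklore] -/
theorem norm_natCast_residueCard_lt_one (v : HeightOneSpectrum (𝓞 K))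
    (hv : ((p : ℕ) : 𝓞 K) ∈ v.asIdeal) : ‖(v.residueCard : PadicAlgCl p)‖ < 1 := by
  obtain ⟨f, hf, hfeq⟩ := residueCard_eq_prime_pow v hv
  rw [hfeq, Nat.cast_pow, norm_pow]
  have hp : ‖(p : PadicAlgCl p)‖ < 1 := by
    rw [← map_natCast (algebraMap ℚ_[p] (PadicAlgCl p)) p]
    change ‖((p : ℚ_[p]) : PadicAlgCl p)‖ < 1
    rw [PadicAlgCl.norm_extends]
    exact Padic.norm_p_lt_one
  exact pow_lt_one₀ (norm_nonneg _) hp hf.ne'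

omit [NumberField K] in
/-- For `σ` of finite image every `det σ(g)` is a root of unity, hence of `p`-adic absolute value
`1`. [folklore] -/
theorem norm_det_eq_one_of_finite (σ : FramedGaloisRep K (PadicAlgCl p) 2)
    (hfin : Finite σ.toMonoidHom.range) (g : Field.absoluteGaloisGroup K) :
    ‖((σ g : GL (Fin 2) (PadicAlgCl p)) : Matrix (Fin 2) (Fin 2) (PadicAlgCl p)).det‖ = 1 := by
  haveI := hfin
  have hfo : IsOfFinOrder (⟨σ.toMonoidHom g, ⟨g, rfl⟩⟩ : σ.toMonoidHom.range) :=
    isOfFinOrder_of_finite _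
  obtain ⟨n, hn, hpow⟩ := hfo.exists_pow_eq_one
  have hpow' : (σ g : GL (Fin 2) (PadicAlgCl p)) ^ n = 1 := by
    have h := congrArg Subtype.val hpow
    simp only [Subgroup.coe_pow, Subgroup.coe_one] at h
    exact h
  have hdet : (((σ g : GL (Fin 2) (PadicAlgCl p)) : Matrix (Fin 2) (Fin 2) (PadicAlgCl p)).det) ^ n = 1 := by
    rw [← Matrix.det_pow, ← Units.val_pow_eq_pow_val, hpow', Units.val_one, Matrix.det_one]
  have := congrArg norm hdet
  rw [norm_pow, norm_one] at this
  exact (pow_eq_one_iff_of_nonneg (norm_nonneg _) hn.ne').1 this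

/-- The constant coefficient of Hansen's degree-`2` Hecke–Frobenius polynomial
`X² − t₁ X + q t₂` is `q · t₂`. [folklore] -/
theorem coeff_zero_heckeFrobPoly_two {A : Type*} [CommRing A] (q : ℕ) (t : ℕ → A) :
    (heckeFrobPoly q 2 t).coeff 0 = (q : A) * t 2 := by
  unfold heckeFrobPoly
  simp [Finset.sum_range_succ, Polynomial.coeff_X_pow]

/-- **No association over `p` with `p`-integral `t₂`.**  For `σ : Γ_K → GL₂(ℚ̄_p)` of finite image,
a place `v` over `p` and eigenvalues `t` with `‖t 2‖ ≤ 1`, Hansen's association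
`charpoly σ(Frob_v⁻¹) = X² − t₁ X + q_v t₂` fails: constant coefficients give
`det σ(Frob_v⁻¹) = q_v t₂`, of absolute value `1` on the left and `< 1` on the right.
[folklore] -/
theorem not_isHeckeAssociatedAt_of_mem (σ : FramedGaloisRep K (PadicAlgCl p) 2)
    (hfin : Finite σ.toMonoidHom.range) (v : HeightOneSpectrum (𝓞 K))
    (hv : ((p : ℕ) : 𝓞 K) ∈ v.asIdeal) (t : ℕ → PadicAlgCl p) (ht : ‖t 2‖ ≤ 1) :
    ¬ σ.IsHeckeAssociatedAt v t := by
  intro h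
  obtain ⟨𝔓, h𝔓⟩ := v.primesAbove_nonempty
  obtain ⟨φ, hφ⟩ := HeightOneSpectrum.exists_isArithFrobAt_of_mem_primesAbove_holds h𝔓
  have hchar := h.2 𝔓 h𝔓 φ hφ
  have h0 := congrArg (fun P : (PadicAlgCl p)[X] => P.coeff 0) hchar
  simp only [coeff_zero_heckeFrobPoly_two] at h0
  have hdet : ((σ φ⁻¹ : GL (Fin 2) (PadicAlgCl p)) : Matrix (Fin 2) (Fin 2) (PadicAlgCl p)).det =
      (v.residueCard : PadicAlgCl p) * t 2 := by
    rw [Matrix.det_eq_sign_charpoly_coeff, ← h0]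
    simp [FramedRep.charpoly]
  have h1 := norm_det_eq_one_of_finite σ hfin φ⁻¹
  rw [hdet, norm_mul] at h1
  have h2 := norm_natCast_residueCard_lt_one (p := p) v hv
  nlinarith [norm_nonneg (t 2), norm_nonneg ((v.residueCard : ℕ) : PadicAlgCl p)]

/-- **Under the association clause of R′'s hypothesis package no place over `p` is good** (the
eigenvalues are `𝒪_{ℚ̄_p}`-valued, so `‖a_{v,2}‖ ≤ 1`): the binder `p ∈ S₀` is implied by the rest
of the package, up to the choice of `S₀`. [folklore] -/
theorem places_over_p_bad_of_assoc (σ : FramedGaloisRep K (PadicAlgCl p) 2)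
    (hfin : Finite σ.toMonoidHom.range) (S₀ : Finset ℕ)
    (a : {v : HeightOneSpectrum (𝓞 K) // ∀ ℓ ∈ S₀, ((ℓ : ℕ) : 𝓞 K) ∉ v.asIdeal} → ℕ →
      (Valued.v (R := PadicAlgCl p)).valuationSubring)
    (hassoc : ∀ (v : HeightOneSpectrum (𝓞 K)) (hv : ∀ ℓ ∈ S₀, ((ℓ : ℕ) : 𝓞 K) ∉ v.asIdeal),
      σ.IsHeckeAssociatedAt v (fun i : ℕ => if i = 0 then (1 : PadicAlgCl p) else
        ((a ⟨v, hv⟩ i : (Valued.v (R := PadicAlgCl p)).valuationSubring) : PadicAlgCl p)))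
    (v : HeightOneSpectrum (𝓞 K)) (hv : ((p : ℕ) : 𝓞 K) ∈ v.asIdeal) :
    ¬ (∀ ℓ ∈ S₀, ((ℓ : ℕ) : 𝓞 K) ∉ v.asIdeal) := by
  intro hgood
  refine not_isHeckeAssociatedAt_of_mem σ hfin v hv _ ?_ (hassoc v hgood)
  simp only [OfNat.ofNat_ne_zero, if_false]
  have : Valued.v (((a ⟨v, hgood⟩ 2 : (Valued.v (R := PadicAlgCl p)).valuationSubring) : PadicAlgCl p)) ≤ 1 :=
    (a ⟨v, hgood⟩ 2).2
  rw [PadicAlgCl.valuation_def] at this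
  exact_mod_cast this

/-- Corollary: **in the hypothesis package of R′ with `S₀ = ∅` (or any `S₀` avoiding `p`) the
association clause is unsatisfiable** — every place over `p` would be good.  So the mutation
"replace `p ∈ S₀` by `p ∉ S₀`" makes R′ vacuously true, not false. [folklore] -/
theorem assoc_false_of_forall_good (σ : FramedGaloisRep K (PadicAlgCl p) 2)
    (hfin : Finite σ.toMonoidHom.range) (S₀ : Finset ℕ)
    (hS : ∀ v : HeightOneSpectrum (𝓞 K), ((p : ℕ) : 𝓞 K) ∈ v.asIdeal →
      ∀ ℓ ∈ S₀, ((ℓ : ℕ) : 𝓞 K) ∉ v.asIdeal)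
    (a : {v : HeightOneSpectrum (𝓞 K) // ∀ ℓ ∈ S₀, ((ℓ : ℕ) : 𝓞 K) ∉ v.asIdeal} → ℕ →
      (Valued.v (R := PadicAlgCl p)).valuationSubring)
    (hassoc : ∀ (v : HeightOneSpectrum (𝓞 K)) (hv : ∀ ℓ ∈ S₀, ((ℓ : ℕ) : 𝓞 K) ∉ v.asIdeal),
      σ.IsHeckeAssociatedAt v (fun i : ℕ => if i = 0 then (1 : PadicAlgCl p) else
        ((a ⟨v, hv⟩ i : (Valued.v (R := PadicAlgCl p)).valuationSubring) : PadicAlgCl p))) :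
    False := by
  -- a place over `p` exists: a prime factor of `(p) ≠ ⊤`
  have hne : Ideal.span {((p : ℕ) : 𝓞 K)} ≠ ⊤ := by
    rw [Ne, Ideal.span_singleton_eq_top]
    intro hu
    have h4 := hu.map (Algebra.norm ℤ)
    rw [show ((p : ℕ) : 𝓞 K) = algebraMap ℤ (𝓞 K) (p : ℤ) by simp, Algebra.norm_algebraMap,
      NumberField.RingOfIntegers.rank, isUnit_pow_iff (Module.finrank_pos).ne',
      Int.isUnit_iff_natAbs_eq, Int.natAbs_natCast] at h4
    exact (Fact.out : p.Prime).one_lt.ne' h4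
  obtain ⟨𝔭, h𝔭max, hle⟩ := Ideal.exists_le_maximal _ hne
  have h𝔭0 : 𝔭 ≠ ⊥ := by
    intro h
    rw [h, le_bot_iff, Ideal.span_singleton_eq_bot] at hle
    exact (Fact.out : p.Prime).ne_zero (by exact_mod_cast hle)
  let v : HeightOneSpectrum (𝓞 K) := ⟨𝔭, h𝔭max.isPrime, h𝔭0⟩
  have hv : ((p : ℕ) : 𝓞 K) ∈ v.asIdeal := hle (Ideal.mem_span_singleton_self _)
  exact places_over_p_bad_of_assoc σ hfin S₀ a hassoc v hv (hS v hv)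

end Summit.Langlands.Langlands.Theorems.ArtinWeightRealisationLevel.Negative

end
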